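/-
Copyright (c) 2026 the pub-hodgecm-mathlib formalisation cell (harness21).  Prover seat hodgecm-mathlib-LH7-p04 (g12), 2026-09-03.
Road M6 → F3 «TOT-Λ BY OVER-ORDERS» (LEAD F0P3a-plan (g16) T14-66; sigsheet SIG-F3-5 v1 6925585c (LH7-p04 (g11)), F3-5 pen by (α)-lineage), brick F3-5a «THE STRATA TOTAL».
-/
import Literature.NumberTheory.Automorphic.SelfDualOverOrderPartition   -- ★ F3-2b FILE 2 (LH7-p04 (g11)) p852999: (B1) `exists_subring_span_image_eq_of_selfDual`, (A8) `eq_of_span_image_eq_span_image`, `map_span_image_le_of_mem`, `exists_linearEquiv_eq_mulVec`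
import Literature.NumberTheory.Automorphic.GluedOverOrdersExhaustion    -- ★ (c3) (LH10-p01 (g10)) p853024: `exists_coe_eq_glued_of_glued_subset`; brings ★ F3-1a `GluedOverOrders` (`glued_subset_glued_iff`, `glued_eq_glued_iff`, `glued_subset_glued`)
import Literature.NumberTheory.Automorphic.OverOrderIntegralReading     -- ★ (c4) (LH10-p01 (g10)) p853025: `coe_subset_range_prodMap_subtype_of_coe_eq`, `map_comap_prodMap_subtype_eq`, `comap_map_prodMap_subtype_eq`, `mk_mem_comap_prodMap_subtype`
import Literature.NumberTheory.Automorphic.LatticeIndexGL               -- ★ `IsUniformizingElement` (`irreducible_coe`, `coe_ne_zero`), `natCard_quotient_span_pow`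
import HarnessLib

/-!
# The self-dual `τ`-stable lattices counted over the glued over-orders: `#{Λ} = Σ_{b ≡ cls} Σ_{N″ ≤ N} w(N″, b)·H(N″, b)` (the over-order law's double sum)

Topic `NumberTheory/Automorphic`; namespace `Literature.NumberTheory.Automorphic`.  THEOREMS ONLY (no definition, no instance, no notation, no named fact, no `sorry`).
Cell `pub/hodgecm-mathlib` (D-0151), crux H413 = `stmt-HodgeConjecture-24833`; road M6 → F3 «TOT-Λ by over-orders» (route (B), gate F3-0 = FIT), brick **F3-5a** = sigsheet
SIG-F3-5 v1 (6925585c) steps (S3) PARTITION + (S4)∕(S5)∕(S6) PER-STRATUM VERDICTS (as binders) + (S7) REINDEX, in the SPAN currency of ★ F3-2b and the E-currency of ★ F3-1a.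
HONEST LABEL: HC_CM is proved only modulo the 2 remaining named inputs (hLiu418 24832, h413 24833) until rung 0 closes; pure reindexing (set algebra + finite sums),
asserts nothing printed; count-neutral (pays no organ; zero label movement until F5 ★ and a desk-priced rider).

FRAME.  ★ F3-2b FILE 2's endoscopic frame VERBATIM (`E` with a `ValuativeRel`, involutions `σ`, `σ_K`, `[K : E] = 2`, `J ∈ GL₃(𝒪)`, a regular `τ` with cyclic vector `w₀`, the
carrier `φ : E × K → M₃(E)` with `φ τ_B = τ`, the adjoint `hstar`, the binder `hordσ`), read INTEGRALLY as in ★ (c4) (`K` valued, `algebraMap E K (𝒪_E) ⊆ 𝒪_K`, the structure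
map `jO : 𝒪_E → 𝒪_K`, `incl = (coe, coe) : 𝒪_E × 𝒪_K → E × K`), with ★ F3-1a's Eisenstein letters at `O₁ := 𝒪_K` (`θ`, `θ² = jO a·θ + jO k`, unique coordinates `hcoord`,
`π = ⟨ϖ, _⟩` a uniformiser of the DVR `𝒪_E`, residue field finite) and an abstract ring map `σO : 𝒪_E → 𝒪_E` (the integral involution; it only enters the HERMITIAN predicate).
The TYPE-(2) ORDER is an integral point `x_R` over `τ_B` whose generated subring `𝒪_E[x_R]` is, as a set, ★ F3-1a's glued order `G(N, n, c_R)` (carve (c6) «R is glued»,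
★ (UG)(iv)'s token shape).  Inline tokens (no `def`): the glued set `G(N″, b, c′) = {(y, jO b₀ + jO c₀·Π_{N″}) | y ≡ b₀ + c₀c′ (π^b)}`, `Π_{N″} = jO(π^{N″})·θ`; the stratum
`S_O = {Λ | (∃ u ∈ U(σ,J), Λ = Λ(u)) ∧ ∃ w, Λ = Λ_O(w)}` of ★ F3-2a∕F3-2b; the class predicate `P(N″, b, c′) := σO c′ ≡ c′ (π^b) ∧ (b = 0 ∨ Lvl_E(N″, b, c′)) ∧ π^{N−N″}c′ ≡ c_R (π^b)`
(HERMITIAN ∧ MONOGENIC LEVEL ∧ COMPATIBLE — carve (c12)'s left subtype, token for token); the torsor size `w(N″, 0) = q^{N″}`, `w(N″, b) = (q+1)q^{N″+b−1}` (`b ≥ 1`).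

THE MATHEMATICS.  (§1) Parameters of glued sets are read back (`G(N″,b,c′) = G(N₁″,b₁,c₁′) ⟺ N″ = N₁″ ∧ b = b₁ ∧ c′ ≡ c₁′`, from ★ `glued_subset_glued_iff` both ways); the diagonal
lies in every `G`; a subring over the diagonal containing `x` contains `𝒪_E[x]`.  (§2) THE STRATA TOTAL: the self-dual `τ`-stable lattices are the DISJOINT union, over
`b ≤ n`, `N″ ≤ N` and the classes `c′ mod π^b` with `P(N″, b, c′)`, of the strata `S_{incl G(N″,b,c′)}` — `⊆`: a self-dual `Λ` is cyclic over its multiplier ring `O(Λ)` (★ (B1)),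
`O(Λ) ⊆ 𝒪_E × 𝒪_K` (★ (c4)) contains the diagonal and `x_R` (`τ`-stability), hence `G(N, n, c_R)`, so it is a lawful compatible `G(N″, b, c′)` (★ (c3)), and the binder `hzero`
(F3-5b: ★ (B3a)(S3′) hermitian + ★ (B3b)(ii) level) upgrades `c′` to `P`; `⊇`: `x_R ∈ G(N,n,c_R) ⊆ G(N″,b,c′)` (★ `glued_subset_glued`) gives `τ`-stability (★ `map_span_image_le_of_mem`);
DISJOINT: a common `Λ` forces equal multiplier rings (★ (A8) `eq_of_span_image_eq_span_image`), equal integral preimages (★ (c4)), equal parameters (§1).  Per stratum the binders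
`hgood` (right parity `b ≡ cls`: `#S = w(N″,b)` — F3-5b: ★ (UG)∕(UG-idx) + ★ (c4) §3 + ★ F3-2a + ★ (c10)) and `hbad` (wrong parity: `S = ∅` — ★ (c8) gate + ★ F3-2a) give the value,
so `#{Λ} = Σ_{b ≤ n, b ≡ cls} Σ_{N″ ≤ N} w(N″,b)·H(N″,b)` with `H(N″,b) = #{c′ mod π^b | P(N″,b,c′)}` — EXACTLY ★ F3-4 `overOrderLawSum_classOne_eq_phiTHn ∕ _classTwo_eq_phiTHprimen`'s
double sum (F3-5b rewrites `H` through ★ (c12) `natCard_hermitianLevelClasses_eq_natCard_levelChars` and ★ (S7b) `natCard_levelChars_*` into F3-4's `hH0 ∕ hHodd ∕ hHeven`).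

* §1 `glued_eq_glued_iff_params`, `diag_mem_glued`, `eval₂_mem_of_mem`, `range_eval₂_subset_coe_of_mem`.
* §2 **`ncard_setOf_selfDual_stable_eq_lawSum`** (F3-5a).

## References
* [Jacobowitz1962] R. Jacobowitz, *Hermitian forms over local fields*, Amer. J. Math. 84 (1962): §7 (unimodular lattices partitioned by their orders; lattices of an order as a units-torsor).
* [Neukirch1999] J. Neukirch, *Algebraic Number Theory*, Grundlehren 322 (1999): Ch. I §12 (orders, conductors, fibre products of orders).
* [Rogawski1990] J. D. Rogawski, *Automorphic Representations of Unitary Groups in Three Variables*, Ann. of Math. Stud. 123 (1990): §4.9 Lemma 4.9.3 p. 56, Prop. 4.9.1 (b) p. 55.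
* [Flicker1998UnitaryFL] Y. Z. Flicker, *Elementary proof of the fundamental lemma for a unitary group*, Canad. J. Math. 50 (1998): Props. 7, 11, 16–17 (the double sums this file produces).
-/

set_option autoImplicit false

noncomputable section

open Matrix Polynomial
open scoped MatrixGroups ValuativeRel Pointwise

namespace Literature.NumberTheory.Automorphic

open Literature.NumberTheory.Automorphic.UnitaryGroup

/-! ## §1 Glued sets: parameters read back, the diagonal, the generated subring -/

section Glued

variable {E : Type*} [Field E] [ValuativeRel E] {O₁ : Type*} [CommRing O₁] (j : 𝒪[E] →+* O₁) (θ : O₁) (ϖO : 𝒪[E])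
  (hcoord : ∀ z : O₁, ∃! bc : 𝒪[E] × 𝒪[E], z = j bc.1 + j bc.2 * θ)

include hcoord in
/-- **PARAMETERS ARE READ BACK**: `G(N″, b, c′) = G(N₁″, b₁, c₁′) ⟺ N″ = N₁″ ∧ b = b₁ ∧ c′ ≡ c₁′ (mod ϖ^b)` (`ϖ` a non-zero non-unit) — ★ F3-1a `glued_subset_glued_iff` read in
both directions. [cite: Neukirch1999, Ch. I §12] -/
theorem glued_eq_glued_iff_params (hϖ0 : ϖO ≠ 0) (hϖu : ¬ IsUnit ϖO) (N'' b : ℕ) (c' : 𝒪[E]) (N₁'' b₁ : ℕ) (c₁' : 𝒪[E]) :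
    {z : 𝒪[E] × O₁ | ∃ b₀ c₀ : 𝒪[E], z.2 = j b₀ + j c₀ * (j (ϖO ^ N'') * θ) ∧ z.1 - (b₀ + c₀ * c') ∈ Ideal.span {ϖO ^ b}} =
        {z : 𝒪[E] × O₁ | ∃ b₀ c₀ : 𝒪[E], z.2 = j b₀ + j c₀ * (j (ϖO ^ N₁'') * θ) ∧ z.1 - (b₀ + c₀ * c₁') ∈ Ideal.span {ϖO ^ b₁}} ↔
      N'' = N₁'' ∧ b = b₁ ∧ c' - c₁' ∈ Ideal.span {ϖO ^ b} := by
  constructor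
  · intro h
    obtain ⟨hN₁, hb₁, -⟩ := (glued_subset_glued_iff j θ ϖO hcoord c' c₁' hϖ0 hϖu).1 h.le
    obtain ⟨hN, hb, hc⟩ := (glued_subset_glued_iff j θ ϖO hcoord c₁' c' hϖ0 hϖu).1 h.ge
    have hNN : N'' = N₁'' := le_antisymm hN hN₁
    have hbb : b = b₁ := le_antisymm hb hb₁
    subst hNN hbb
    refine ⟨rfl, rfl, ?_⟩
    rwa [Nat.sub_self, pow_zero, one_mul] at hc
  · rintro ⟨rfl, rfl, hc⟩
    exact (glued_eq_glued_iff j θ ϖO hcoord N'' b c' c₁' hϖ0).2 hc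

/-- The diagonal `(y, j y)` lies in every glued set (`b₀ = y`, `c₀ = 0`). [cite: Neukirch1999, Ch. I §12] -/
theorem diag_mem_glued (N'' b : ℕ) (c' y : 𝒪[E]) :
    ((y, j y) : 𝒪[E] × O₁) ∈ {z : 𝒪[E] × O₁ | ∃ b₀ c₀ : 𝒪[E], z.2 = j b₀ + j c₀ * (j (ϖO ^ N'') * θ) ∧ z.1 - (b₀ + c₀ * c') ∈ Ideal.span {ϖO ^ b}} :=
  ⟨y, 0, by simp, by simp⟩

/-- A subring of `𝒪 × O₁` over the diagonal containing `x` contains every polynomial `Σ (cᵢ, j cᵢ)·xⁱ` in `x`. [cite: Neukirch1999, Ch. I §12] -/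
theorem eval₂_mem_of_mem (S : Subring (𝒪[E] × O₁)) (hδ : ∀ y : 𝒪[E], ((y, j y) : 𝒪[E] × O₁) ∈ S) {x : 𝒪[E] × O₁} (hx : x ∈ S) (p : Polynomial 𝒪[E]) :
    Polynomial.eval₂RingHom (RingHom.prod (RingHom.id 𝒪[E]) j) x p ∈ S := by
  induction p using Polynomial.induction_on' with
  | add p q hp hq => rw [map_add]; exact S.add_mem hp hq
  | monomial m c =>
    rw [Polynomial.coe_eval₂RingHom, Polynomial.eval₂_monomial]
    exact S.mul_mem (hδ c) (S.pow_mem hx m)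

/-- … hence it contains the subring `𝒪[x]` generated by `x` over the diagonal. [cite: Neukirch1999, Ch. I §12] -/
theorem range_eval₂_subset_coe_of_mem (S : Subring (𝒪[E] × O₁)) (hδ : ∀ y : 𝒪[E], ((y, j y) : 𝒪[E] × O₁) ∈ S) {x : 𝒪[E] × O₁} (hx : x ∈ S) :
    ((Polynomial.eval₂RingHom (RingHom.prod (RingHom.id 𝒪[E]) j) x).range : Set (𝒪[E] × O₁)) ⊆ (S : Set (𝒪[E] × O₁)) := by
  rintro _ ⟨p, rfl⟩
  exact eval₂_mem_of_mem j S hδ hx p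

end Glued

/-! ## §2 The strata total (F3-5a) -/

section Total

variable {E : Type*} [Field E] [ValuativeRel E] (σ : E →+* E) {K : Type*} [Field K] [ValuativeRel K] [Algebra E K] (σK : K →+* K)
  (hσσ : ∀ x, σ (σ x) = x) (hσK : ∀ x, σK (σK x) = x) (hσO : ∀ x : 𝒪[E], σ x ∈ 𝒪[E]) (hK2 : Module.finrank E K = 2)
  (J : GL (Fin 3) E) (hJ : J ∈ glInt 3 E)
  (τ : Matrix (Fin 3) (Fin 3) E) {w₀ : Fin 3 → E} (hK : IsUnit (Matrix.of fun i j : Fin 3 => ((τ ^ (j : ℕ)) *ᵥ w₀) i).det)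
  (φ : (E × K) →ₐ[E] Matrix (Fin 3) (Fin 3) E) (hφ : Function.Injective φ) (τB : E × K) (hτB : φ τB = τ)
  (hstar : ∀ b : E × K, (J : Matrix (Fin 3) (Fin 3) E) * φ (RingHom.prodMap σ σK b) = ((φ b).map σ)ᵀ * J)
  (hordσ : ∀ L : Submodule 𝒪[E] K, L.FG → ∀ c : K, c • L ≤ L → σK c • L ≤ L)
  (hOK : ∀ r : 𝒪[E], algebraMap E K (r : E) ∈ 𝒪[K])
  (jO : 𝒪[E] →+* 𝒪[K]) (hjO : ∀ x : 𝒪[E], ((jO x : 𝒪[K]) : K) = algebraMap E K x)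
  (θ : 𝒪[K]) {a k : 𝒪[E]} (hθ : θ * θ = jO a * θ + jO k) (hcoord : ∀ z : 𝒪[K], ∃! bc : 𝒪[E] × 𝒪[E], z = jO bc.1 + jO bc.2 * θ)
  {ϖ : E} (hϖ : IsUniformizingElement ϖ) (σO : 𝒪[E] →+* 𝒪[E])
  (xR : 𝒪[E] × 𝒪[K]) (hxR : RingHom.prodMap (𝒪[E]).subtype (𝒪[K]).subtype xR = τB) {N n : ℕ} (cR : 𝒪[E])
  {q : ℕ} (hq : 0 < q) (cls : ℕ)

include hσσ hσK hσO hK2 hJ hK hφ hτB hstar hordσ hOK hjO hθ hcoord hxR hq in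
/-- **F3-5a — THE STRATA TOTAL OF THE SELF-DUAL `τ`-STABLE LATTICES IS THE OVER-ORDER LAW'S DOUBLE SUM.**  In ★ F3-2b's endoscopic frame read integrally (★ (c4)), with the
type-(2) order `𝒪_E[x_R] = G(N, n, c_R)` (`hR`, carve (c6)) over `τ_B = incl x_R`, and with the per-stratum verdicts on the glued over-orders `G(N″, b, c′)` (`N″ ≤ N`, `b ≤ n`) as
BINDERS — `hzero`: a lawful compatible stratum that is non-empty has a HERMITIAN character value at a MONOGENIC LEVEL; `hgood`: a hermitian, monogenic-level, compatible class of the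
RIGHT parity `b ≡ cls (2)` carries a glued subring whose stratum has `w(N″, b)` elements (`w(N″, 0) = q^{N″}`, `w(N″, b) = (q+1)q^{N″+b−1}`); `hbad`: of the WRONG parity, an empty stratum —
the number of self-dual `τ`-stable lattices is `Σ_{b ≤ n, b ≡ cls} Σ_{N″ ≤ N} w(N″, b)·H(N″, b)`, `H(N″, b) = #{c′ mod π^b | hermitian ∧ (b = 0 ∨ Lvl_E(N″,b,c′)) ∧ π^{N−N″}c′ ≡ c_R}`,
in ★ F3-4 `overOrderLawSum_classOne_eq_phiTHn ∕ _classTwo_eq_phiTHprimen`'s exact shape.  [cite: Jacobowitz1962, §7] [cite: Neukirch1999, Ch. I §12]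
[cite: Rogawski1990, §4.9 Lemma 4.9.3 p. 56, Prop. 4.9.1 (b) p. 55] [cite: Flicker1998UnitaryFL, Props. 7, 11, 16–17] -/
theorem ncard_setOf_selfDual_stable_eq_lawSum [IsDiscreteValuationRing 𝒪[E]] [Finite 𝓀[E]]
    (hR : ((Polynomial.eval₂RingHom (RingHom.prod (RingHom.id 𝒪[E]) jO) xR).range : Set (𝒪[E] × 𝒪[K])) =
      {z : 𝒪[E] × 𝒪[K] | ∃ b₀ c₀ : 𝒪[E], z.2 = jO b₀ + jO c₀ * (jO ((⟨ϖ, hϖ.mem⟩ : 𝒪[E]) ^ N) * θ) ∧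
        z.1 - (b₀ + c₀ * cR) ∈ Ideal.span {(⟨ϖ, hϖ.mem⟩ : 𝒪[E]) ^ n}})
    (hzero : ∀ N'' ≤ N, ∀ b ≤ n, ∀ c' : 𝒪[E],
      c' * c' - ((⟨ϖ, hϖ.mem⟩ : 𝒪[E]) ^ N'' * a * c' + (⟨ϖ, hϖ.mem⟩ : 𝒪[E]) ^ (2 * N'') * k) ∈ Ideal.span {(⟨ϖ, hϖ.mem⟩ : 𝒪[E]) ^ b} →
      (⟨ϖ, hϖ.mem⟩ : 𝒪[E]) ^ (N - N'') * c' - cR ∈ Ideal.span {(⟨ϖ, hϖ.mem⟩ : 𝒪[E]) ^ b} →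
      ∀ S : Subring (𝒪[E] × 𝒪[K]), (S : Set (𝒪[E] × 𝒪[K])) =
        {z : 𝒪[E] × 𝒪[K] | ∃ b₀ c₀ : 𝒪[E], z.2 = jO b₀ + jO c₀ * (jO ((⟨ϖ, hϖ.mem⟩ : 𝒪[E]) ^ N'') * θ) ∧
          z.1 - (b₀ + c₀ * c') ∈ Ideal.span {(⟨ϖ, hϖ.mem⟩ : 𝒪[E]) ^ b}} →
      {Λ : Submodule 𝒪[E] (Fin 3 → E) |
          (∃ u ∈ unitaryGroupOfForm σ (J : Matrix (Fin 3) (Fin 3) E), Λ = Submodule.span 𝒪[E] (Set.range ((u : Matrix (Fin 3) (Fin 3) E))ᵀ)) ∧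
            ∃ w : Fin 3 → E, Λ = Submodule.span 𝒪[E] ((fun x : E × K => φ x *ᵥ w) ''
              ((S.map (RingHom.prodMap (𝒪[E]).subtype (𝒪[K]).subtype) : Subring (E × K)) : Set (E × K)))}.Nonempty →
      σO c' - c' ∈ Ideal.span ({(⟨ϖ, hϖ.mem⟩ : 𝒪[E]) ^ b} : Set 𝒪[E]) ∧
        (b = 0 ∨ (b = 2 * N'' + 1 ∧ c' ∈ Ideal.span ({(⟨ϖ, hϖ.mem⟩ : 𝒪[E]) ^ (N'' + 1)} : Set 𝒪[E])) ∨
          ∃ M : ℕ, 1 ≤ M ∧ M ≤ N'' ∧ b = 2 * M ∧ c' ∈ Ideal.span ({(⟨ϖ, hϖ.mem⟩ : 𝒪[E]) ^ M} : Set 𝒪[E]) ∧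
            c' ∉ Ideal.span ({(⟨ϖ, hϖ.mem⟩ : 𝒪[E]) ^ (M + 1)} : Set 𝒪[E])))
    (hgood : ∀ N'' ≤ N, ∀ b ≤ n, ∀ c' : 𝒪[E],
      σO c' - c' ∈ Ideal.span ({(⟨ϖ, hϖ.mem⟩ : 𝒪[E]) ^ b} : Set 𝒪[E]) →
      (b = 0 ∨ (b = 2 * N'' + 1 ∧ c' ∈ Ideal.span ({(⟨ϖ, hϖ.mem⟩ : 𝒪[E]) ^ (N'' + 1)} : Set 𝒪[E])) ∨
          ∃ M : ℕ, 1 ≤ M ∧ M ≤ N'' ∧ b = 2 * M ∧ c' ∈ Ideal.span ({(⟨ϖ, hϖ.mem⟩ : 𝒪[E]) ^ M} : Set 𝒪[E]) ∧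
            c' ∉ Ideal.span ({(⟨ϖ, hϖ.mem⟩ : 𝒪[E]) ^ (M + 1)} : Set 𝒪[E])) →
      (⟨ϖ, hϖ.mem⟩ : 𝒪[E]) ^ (N - N'') * c' - cR ∈ Ideal.span ({(⟨ϖ, hϖ.mem⟩ : 𝒪[E]) ^ b} : Set 𝒪[E]) →
      b % 2 = cls →
      ∃ S : Subring (𝒪[E] × 𝒪[K]), (S : Set (𝒪[E] × 𝒪[K])) =
        {z : 𝒪[E] × 𝒪[K] | ∃ b₀ c₀ : 𝒪[E], z.2 = jO b₀ + jO c₀ * (jO ((⟨ϖ, hϖ.mem⟩ : 𝒪[E]) ^ N'') * θ) ∧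
          z.1 - (b₀ + c₀ * c') ∈ Ideal.span {(⟨ϖ, hϖ.mem⟩ : 𝒪[E]) ^ b}} ∧
      {Λ : Submodule 𝒪[E] (Fin 3 → E) |
          (∃ u ∈ unitaryGroupOfForm σ (J : Matrix (Fin 3) (Fin 3) E), Λ = Submodule.span 𝒪[E] (Set.range ((u : Matrix (Fin 3) (Fin 3) E))ᵀ)) ∧
            ∃ w : Fin 3 → E, Λ = Submodule.span 𝒪[E] ((fun x : E × K => φ x *ᵥ w) ''
              ((S.map (RingHom.prodMap (𝒪[E]).subtype (𝒪[K]).subtype) : Subring (E × K)) : Set (E × K)))}.ncard =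
        (if b = 0 then q ^ N'' else (q + 1) * q ^ (N'' + b - 1)))
    (hbad : ∀ N'' ≤ N, ∀ b ≤ n, ∀ c' : 𝒪[E],
      σO c' - c' ∈ Ideal.span ({(⟨ϖ, hϖ.mem⟩ : 𝒪[E]) ^ b} : Set 𝒪[E]) →
      (b = 0 ∨ (b = 2 * N'' + 1 ∧ c' ∈ Ideal.span ({(⟨ϖ, hϖ.mem⟩ : 𝒪[E]) ^ (N'' + 1)} : Set 𝒪[E])) ∨
          ∃ M : ℕ, 1 ≤ M ∧ M ≤ N'' ∧ b = 2 * M ∧ c' ∈ Ideal.span ({(⟨ϖ, hϖ.mem⟩ : 𝒪[E]) ^ M} : Set 𝒪[E]) ∧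
            c' ∉ Ideal.span ({(⟨ϖ, hϖ.mem⟩ : 𝒪[E]) ^ (M + 1)} : Set 𝒪[E])) →
      (⟨ϖ, hϖ.mem⟩ : 𝒪[E]) ^ (N - N'') * c' - cR ∈ Ideal.span ({(⟨ϖ, hϖ.mem⟩ : 𝒪[E]) ^ b} : Set 𝒪[E]) →
      b % 2 ≠ cls →
      ∀ S : Subring (𝒪[E] × 𝒪[K]), (S : Set (𝒪[E] × 𝒪[K])) =
        {z : 𝒪[E] × 𝒪[K] | ∃ b₀ c₀ : 𝒪[E], z.2 = jO b₀ + jO c₀ * (jO ((⟨ϖ, hϖ.mem⟩ : 𝒪[E]) ^ N'') * θ) ∧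
          z.1 - (b₀ + c₀ * c') ∈ Ideal.span {(⟨ϖ, hϖ.mem⟩ : 𝒪[E]) ^ b}} →
      {Λ : Submodule 𝒪[E] (Fin 3 → E) |
          (∃ u ∈ unitaryGroupOfForm σ (J : Matrix (Fin 3) (Fin 3) E), Λ = Submodule.span 𝒪[E] (Set.range ((u : Matrix (Fin 3) (Fin 3) E))ᵀ)) ∧
            ∃ w : Fin 3 → E, Λ = Submodule.span 𝒪[E] ((fun x : E × K => φ x *ᵥ w) ''
              ((S.map (RingHom.prodMap (𝒪[E]).subtype (𝒪[K]).subtype) : Subring (E × K)) : Set (E × K)))} = ∅) :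
    {Λ : Submodule 𝒪[E] (Fin 3 → E) |
        (∃ u ∈ unitaryGroupOfForm σ (J : Matrix (Fin 3) (Fin 3) E), Λ = Submodule.span 𝒪[E] (Set.range ((u : Matrix (Fin 3) (Fin 3) E))ᵀ)) ∧
          Λ.map ((Matrix.toLin' τ).restrictScalars 𝒪[E]) ≤ Λ}.ncard =
      ∑ b ∈ (Finset.range (n + 1)).filter (fun b => b % 2 = cls), ∑ N'' ∈ Finset.range (N + 1),
        (if b = 0 then q ^ N'' else (q + 1) * q ^ (N'' + b - 1)) *
          Nat.card {w : 𝒪[E] ⧸ Ideal.span ({(⟨ϖ, hϖ.mem⟩ : 𝒪[E]) ^ b} : Set 𝒪[E]) //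
            ∃ c' : 𝒪[E], Ideal.Quotient.mk _ c' = w ∧ σO c' - c' ∈ Ideal.span ({(⟨ϖ, hϖ.mem⟩ : 𝒪[E]) ^ b} : Set 𝒪[E]) ∧
              ((b = 0 ∨ (b = 2 * N'' + 1 ∧ c' ∈ Ideal.span ({(⟨ϖ, hϖ.mem⟩ : 𝒪[E]) ^ (N'' + 1)} : Set 𝒪[E])) ∨
                  ∃ M : ℕ, 1 ≤ M ∧ M ≤ N'' ∧ b = 2 * M ∧ c' ∈ Ideal.span ({(⟨ϖ, hϖ.mem⟩ : 𝒪[E]) ^ M} : Set 𝒪[E]) ∧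
                    c' ∉ Ideal.span ({(⟨ϖ, hϖ.mem⟩ : 𝒪[E]) ^ (M + 1)} : Set 𝒪[E])) ∧
                (⟨ϖ, hϖ.mem⟩ : 𝒪[E]) ^ (N - N'') * c' - cR ∈ Ideal.span ({(⟨ϖ, hϖ.mem⟩ : 𝒪[E]) ^ b} : Set 𝒪[E]))} := by
  classical
  -- ### 0. Tokens: `π`, `incl`, the glued sets `G`, the strata `St`, the class predicate `P`, the class sets `W`, the pieces `T`
  set π : 𝒪[E] := ⟨ϖ, hϖ.mem⟩ with hπdef
  have hπ0 : π ≠ 0 := hϖ.coe_ne_zero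
  have hπirr : Irreducible π := hϖ.irreducible_coe
  set incl : 𝒪[E] × 𝒪[K] →+* E × K := RingHom.prodMap (𝒪[E]).subtype (𝒪[K]).subtype with hincl
  obtain ⟨G, hG⟩ : ∃ G : ℕ → ℕ → 𝒪[E] → Set (𝒪[E] × 𝒪[K]), ∀ N'' b c', G N'' b c' =
      {z : 𝒪[E] × 𝒪[K] | ∃ b₀ c₀ : 𝒪[E], z.2 = jO b₀ + jO c₀ * (jO (π ^ N'') * θ) ∧ z.1 - (b₀ + c₀ * c') ∈ Ideal.span {π ^ b}} :=
    ⟨_, fun _ _ _ => rfl⟩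
  obtain ⟨St, hSt⟩ : ∃ St : Subring (𝒪[E] × 𝒪[K]) → Set (Submodule 𝒪[E] (Fin 3 → E)), ∀ S, St S =
      {Λ : Submodule 𝒪[E] (Fin 3 → E) |
        (∃ u ∈ unitaryGroupOfForm σ (J : Matrix (Fin 3) (Fin 3) E), Λ = Submodule.span 𝒪[E] (Set.range ((u : Matrix (Fin 3) (Fin 3) E))ᵀ)) ∧
          ∃ w : Fin 3 → E, Λ = Submodule.span 𝒪[E] ((fun x : E × K => φ x *ᵥ w) '' ((S.map incl : Subring (E × K)) : Set (E × K)))} :=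
    ⟨_, fun _ => rfl⟩
  obtain ⟨P, hP⟩ : ∃ P : ℕ → ℕ → 𝒪[E] → Prop, ∀ N'' b c', P N'' b c' =
      (σO c' - c' ∈ Ideal.span ({π ^ b} : Set 𝒪[E]) ∧
        ((b = 0 ∨ (b = 2 * N'' + 1 ∧ c' ∈ Ideal.span ({π ^ (N'' + 1)} : Set 𝒪[E])) ∨
            ∃ M : ℕ, 1 ≤ M ∧ M ≤ N'' ∧ b = 2 * M ∧ c' ∈ Ideal.span ({π ^ M} : Set 𝒪[E]) ∧ c' ∉ Ideal.span ({π ^ (M + 1)} : Set 𝒪[E])) ∧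
          π ^ (N - N'') * c' - cR ∈ Ideal.span ({π ^ b} : Set 𝒪[E]))) :=
    ⟨_, fun _ _ _ => rfl⟩
  obtain ⟨W, hW⟩ : ∃ W : (b : ℕ) → ℕ → Set (𝒪[E] ⧸ Ideal.span ({π ^ b} : Set 𝒪[E])), ∀ b N'', W b N'' =
      {w | ∃ c' : 𝒪[E], Ideal.Quotient.mk (Ideal.span ({π ^ b} : Set 𝒪[E])) c' = w ∧ P N'' b c'} :=
    ⟨_, fun _ _ => rfl⟩
  obtain ⟨T, hT⟩ : ∃ T : (b : ℕ) → ℕ → (𝒪[E] ⧸ Ideal.span ({π ^ b} : Set 𝒪[E])) → Set (Submodule 𝒪[E] (Fin 3 → E)), ∀ b N'' w, T b N'' w =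
      {Λ | ∃ (c' : 𝒪[E]) (S : Subring (𝒪[E] × 𝒪[K])),
        Ideal.Quotient.mk (Ideal.span ({π ^ b} : Set 𝒪[E])) c' = w ∧ P N'' b c' ∧ (S : Set (𝒪[E] × 𝒪[K])) = G N'' b c' ∧ Λ ∈ St S} :=
    ⟨_, fun _ _ _ => rfl⟩
  -- ### 1. The diagonal, the scalars, `x_R`
  have hincl_diag : ∀ y : 𝒪[E], incl ((y, jO y) : 𝒪[E] × 𝒪[K]) = algebraMap E (E × K) (y : E) := fun y => by
    rw [Prod.algebraMap_apply, Algebra.algebraMap_self, RingHom.id_apply, ← hjO]; rfl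
  have hsc : ∀ (S : Subring (𝒪[E] × 𝒪[K])) (N'' b : ℕ) (c' : 𝒪[E]), (S : Set (𝒪[E] × 𝒪[K])) = G N'' b c' →
      ∀ r : 𝒪[E], algebraMap E (E × K) (r : E) ∈ S.map incl := by
    intro S N'' b c' hS r
    rw [← hincl_diag]
    refine Subring.mem_map.2 ⟨(r, jO r), ?_, rfl⟩
    rw [← SetLike.mem_coe, hS, hG]
    exact diag_mem_glued jO θ π N'' b c' r
  have hxRG : xR ∈ G N n cR := by
    rw [hG, ← hR]
    exact ⟨Polynomial.X, by rw [Polynomial.coe_eval₂RingHom, Polynomial.eval₂_X]⟩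
  -- ### 2. Two strata with a common lattice have the same parameters ((A8) + (c4) + §1)
  have hcore : ∀ {Λ : Submodule 𝒪[E] (Fin 3 → E)} {S S₁ : Subring (𝒪[E] × 𝒪[K])} {N'' b : ℕ} {c' : 𝒪[E]} {N₁'' b₁ : ℕ} {c₁' : 𝒪[E]},
      (S : Set (𝒪[E] × 𝒪[K])) = G N'' b c' → (S₁ : Set (𝒪[E] × 𝒪[K])) = G N₁'' b₁ c₁' → Λ ∈ St S → Λ ∈ St S₁ →
        N'' = N₁'' ∧ b = b₁ ∧ c' - c₁' ∈ Ideal.span {π ^ b} := by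
    intro Λ S S₁ N'' b c' N₁'' b₁ c₁' hS hS₁ hΛ hΛ₁
    rw [hSt] at hΛ hΛ₁
    obtain ⟨⟨g, -, hg⟩, w, hw⟩ := hΛ; obtain ⟨-, w₁, hw₁⟩ := hΛ₁
    have hOO : S.map incl = S₁.map incl :=
      eq_of_span_image_eq_span_image τ hK φ hφ τB hτB (S.map incl) (hsc S N'' b c' hS) (S₁.map incl) (hsc S₁ N₁'' b₁ c₁' hS₁) w w₁ g
        (hw.symm.trans hg) (hw.symm.trans hw₁)
    have hSS : S = S₁ := by rw [← comap_map_prodMap_subtype_eq S, ← comap_map_prodMap_subtype_eq S₁, ← hincl, hOO]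
    have hGG : G N'' b c' = G N₁'' b₁ c₁' := by rw [← hS, ← hS₁, hSS]
    rw [hG, hG] at hGG
    exact (glued_eq_glued_iff_params jO θ π hcoord hπ0 hπirr.not_isUnit N'' b c' N₁'' b₁ c₁').1 hGG
  -- ### 3. (S3) THE COVERING AND ITS CONVERSE: `{Λ} = ⋃_{b, N″, w} T b N″ w`
  have hA : {Λ : Submodule 𝒪[E] (Fin 3 → E) |
        (∃ u ∈ unitaryGroupOfForm σ (J : Matrix (Fin 3) (Fin 3) E), Λ = Submodule.span 𝒪[E] (Set.range ((u : Matrix (Fin 3) (Fin 3) E))ᵀ)) ∧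
          Λ.map ((Matrix.toLin' τ).restrictScalars 𝒪[E]) ≤ Λ} =
      ⋃ b ∈ (↑(Finset.range (n + 1)) : Set ℕ), ⋃ N'' ∈ (↑(Finset.range (N + 1)) : Set ℕ), ⋃ w ∈ W b N'', T b N'' w := by
    ext Λ
    simp only [Set.mem_iUnion, Set.mem_setOf_eq, Finset.coe_range, Set.mem_Iio, exists_prop]
    constructor
    · rintro ⟨⟨u, hu, rfl⟩, hst⟩
      -- (B1): `Λ` is cyclic over its multiplier ring `O`
      obtain ⟨O, hOsc, hOcoe, w, hw⟩ :=
        exists_subring_span_image_eq_of_selfDual σ σK hσσ hσK hσO hK2 J hJ τ hK φ hφ τB hτB hstar hordσ ⟨u, hu, rfl⟩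
      obtain ⟨Ψ, hΨ⟩ := exists_linearEquiv_eq_mulVec τ hK φ hφ τB hτB
      -- (c4): `O ⊆ 𝒪_E × 𝒪_K`; its integral preimage `S` contains the diagonal
      have hOrange : (O : Set (E × K)) ⊆ Set.range incl := coe_subset_range_prodMap_subtype_of_coe_eq hOK φ Ψ hΨ u O hOcoe
      set S : Subring (𝒪[E] × 𝒪[K]) := O.comap incl with hSdef
      have hSO : S.map incl = O := map_comap_prodMap_subtype_eq O hOrange
      have hδ : ∀ y : 𝒪[E], ((y, jO y) : 𝒪[E] × 𝒪[K]) ∈ S := mk_mem_comap_prodMap_subtype jO hjO O hOsc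
      -- `τ`-stability puts `x_R` in `S`, hence `G(N, n, c_R) ⊆ S`
      have hτBO : τB ∈ O := by rw [← SetLike.mem_coe, hOcoe, Set.mem_setOf_eq, hτB]; exact hst
      have hxRS : xR ∈ S := by rw [hSdef, Subring.mem_comap, hxR]; exact hτBO
      have hRS : {z : 𝒪[E] × 𝒪[K] | ∃ b₀ c₀ : 𝒪[E], z.2 = jO b₀ + jO c₀ * (jO (π ^ N) * θ) ∧ z.1 - (b₀ + c₀ * cR) ∈ Ideal.span {π ^ n}} ⊆
          (S : Set (𝒪[E] × 𝒪[K])) := by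
        rw [← hR]; exact range_eval₂_subset_coe_of_mem jO S hδ hxRS
      -- (c3): `S` is a lawful compatible glued order `G(N″, b, c′)`
      obtain ⟨N'', b, c', hN'', hb, hlaw, hcomp, hScoe⟩ := exists_coe_eq_glued_of_glued_subset jO θ π hθ hcoord hπirr S hδ hRS
      have hScoe' : (S : Set (𝒪[E] × 𝒪[K])) = G N'' b c' := by rw [hG]; exact hScoe
      -- the binder `hzero`: hermitian character value at a monogenic level
      have hΛSt : Submodule.span 𝒪[E] (Set.range ((u : Matrix (Fin 3) (Fin 3) E))ᵀ) ∈ St S := by rw [hSt, hSO]; exact ⟨⟨u, hu, rfl⟩, w, hw⟩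
      obtain ⟨hherm, hlvl⟩ := hzero N'' hN'' b hb c' hlaw hcomp S hScoe (by rw [hSt] at hΛSt; exact ⟨_, hΛSt⟩)
      have hPc : P N'' b c' := by rw [hP]; exact ⟨hherm, hlvl, hcomp⟩
      refine ⟨b, by omega, N'', by omega, Ideal.Quotient.mk _ c', ?_, ?_⟩
      · rw [hW]; exact ⟨c', rfl, hPc⟩
      · rw [hT]; exact ⟨c', S, rfl, hPc, hScoe', hΛSt⟩
    · rintro ⟨b, hb, N'', hN'', w, -, hΛ⟩
      rw [hT] at hΛ
      obtain ⟨c', S, -, hPc, hScoe, hΛ⟩ := hΛ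
      rw [hSt] at hΛ; rw [hP] at hPc
      obtain ⟨hsd, w', hw'⟩ := hΛ
      refine ⟨hsd, ?_⟩
      -- `x_R ∈ G(N, n, c_R) ⊆ G(N″, b, c′) = S` (compatibility), so `τ_B ∈ incl S`
      have hxRS : xR ∈ S := by
        rw [← SetLike.mem_coe, hScoe, hG]
        have hx := hxRG; rw [hG] at hx
        exact glued_subset_glued jO θ π cR c' (by omega) (by omega) hPc.2.2 hx
      have hτBO : τB ∈ S.map incl := by rw [← hxR]; exact Subring.mem_map.2 ⟨xR, hxRS, rfl⟩
      rw [hw', ← hτB]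
      exact map_span_image_le_of_mem φ (S.map incl) (hsc S N'' b c' hScoe) τB hτBO w'
  -- ### 4. (S4)–(S6) THE VALUE OF EACH PIECE (binders `hgood` ∕ `hbad`)
  have hval : ∀ b ≤ n, ∀ N'' ≤ N, ∀ w ∈ W b N'',
      (b % 2 = cls → (T b N'' w).ncard = (if b = 0 then q ^ N'' else (q + 1) * q ^ (N'' + b - 1))) ∧
        (b % 2 ≠ cls → T b N'' w = ∅) := by
    intro b hb N'' hN'' w hw
    rw [hW] at hw; obtain ⟨c', hc'w, hPc⟩ := hw
    have hPc' := hPc; rw [hP] at hPc'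
    constructor
    · intro hcls
      obtain ⟨S₀, hS₀, hcard⟩ := hgood N'' hN'' b hb c' hPc'.1 hPc'.2.1 hPc'.2.2 hcls
      have hS₀' : (S₀ : Set (𝒪[E] × 𝒪[K])) = G N'' b c' := by rw [hG]; exact hS₀
      have hTeq : T b N'' w = St S₀ := by
        ext Λ
        rw [hT, Set.mem_setOf_eq]
        constructor
        · rintro ⟨c₁, S₁, hc₁w, -, hS₁, hΛ⟩
          have hcc : c₁ - c' ∈ Ideal.span ({π ^ b} : Set 𝒪[E]) := by rw [← Ideal.Quotient.eq, hc₁w, hc'w]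
          have hS₁₀ : (S₁ : Set (𝒪[E] × 𝒪[K])) = S₀ := by
            rw [hS₁, hS₀', hG, hG]; exact (glued_eq_glued_iff jO θ π hcoord N'' b c₁ c' hπ0).2 hcc
          rwa [SetLike.coe_injective hS₁₀] at hΛ
        · exact fun hΛ => ⟨c', S₀, hc'w, hPc, hS₀', hΛ⟩
      rw [hTeq, hSt]; exact hcard
    · intro hcls
      rw [hT]
      refine Set.eq_empty_of_forall_notMem fun Λ hΛ => ?_
      obtain ⟨c₁, S₁, -, hP₁, hS₁, hΛ⟩ := hΛ
      rw [hP] at hP₁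
      rw [hSt, hbad N'' hN'' b hb c₁ hP₁.1 hP₁.2.1 hP₁.2.2 hcls S₁ (by rw [hS₁, hG])] at hΛ
      exact hΛ
  -- ### 5. Finiteness of the pieces and of the index sets; disjointness
  have hwpos : ∀ N'' b : ℕ, 0 < (if b = 0 then q ^ N'' else (q + 1) * q ^ (N'' + b - 1)) := fun N'' b => by
    split_ifs
    exacts [pow_pos hq _, Nat.mul_pos (Nat.succ_pos q) (pow_pos hq _)]
  have hTfin : ∀ b ≤ n, ∀ N'' ≤ N, ∀ w ∈ W b N'', (T b N'' w).Finite := by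
    intro b hb N'' hN'' w hw
    by_cases hcls : b % 2 = cls
    · exact Set.finite_of_ncard_ne_zero (by rw [(hval b hb N'' hN'' w hw).1 hcls]; exact (hwpos N'' b).ne')
    · rw [(hval b hb N'' hN'' w hw).2 hcls]; exact Set.finite_empty
  have hQfin : ∀ b : ℕ, Finite (𝒪[E] ⧸ Ideal.span ({π ^ b} : Set 𝒪[E])) := fun b => by
    apply Nat.finite_of_card_ne_zero
    rw [natCard_quotient_span_pow hϖ b]
    exact pow_ne_zero _ (Nat.pos_iff_ne_zero.1 Nat.card_pos)
  have hWfin : ∀ b N'', (W b N'').Finite := fun b N'' => by haveI := hQfin b; exact Set.toFinite _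
  have hVfin : ∀ b ≤ n, ∀ N'' ≤ N, (⋃ w ∈ W b N'', T b N'' w).Finite := fun b hb N'' hN'' =>
    (hWfin b N'').biUnion fun w hw => hTfin b hb N'' hN'' w hw
  have hUfin : ∀ b ≤ n, (⋃ N'' ∈ (↑(Finset.range (N + 1)) : Set ℕ), ⋃ w ∈ W b N'', T b N'' w).Finite := fun b hb =>
    (Finset.range (N + 1)).finite_toSet.biUnion fun N'' hN'' =>
      hVfin b hb N'' (by have := Finset.mem_range.1 (Finset.mem_coe.1 hN''); omega)
  have hdisj : ∀ {Λ : Submodule 𝒪[E] (Fin 3 → E)} {b N'' : ℕ} {w : 𝒪[E] ⧸ Ideal.span ({π ^ b} : Set 𝒪[E])} {b₁ N₁'' : ℕ}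
      {w₁ : 𝒪[E] ⧸ Ideal.span ({π ^ b₁} : Set 𝒪[E])}, Λ ∈ T b N'' w → Λ ∈ T b₁ N₁'' w₁ →
        ∃ c' c₁' : 𝒪[E], Ideal.Quotient.mk _ c' = w ∧ Ideal.Quotient.mk _ c₁' = w₁ ∧ N'' = N₁'' ∧ b = b₁ ∧ c' - c₁' ∈ Ideal.span {π ^ b} := by
    intro Λ b N'' w b₁ N₁'' w₁ hΛ hΛ₁
    rw [hT] at hΛ hΛ₁
    obtain ⟨c', S, hc'w, -, hS, hΛ⟩ := hΛ; obtain ⟨c₁', S₁, hc₁'w, -, hS₁, hΛ₁⟩ := hΛ₁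
    exact ⟨c', c₁', hc'w, hc₁'w, hcore hS hS₁ hΛ hΛ₁⟩
  have hVdisj : ∀ b N'', (W b N'').PairwiseDisjoint (T b N'') := by
    intro b N'' w _ w₁ _ hne
    refine Set.disjoint_left.2 fun Λ hΛ hΛ₁ => hne ?_
    obtain ⟨c', c₁', hc, hc₁, -, -, hcc⟩ := hdisj hΛ hΛ₁
    rw [← hc, ← hc₁]; exact Ideal.Quotient.eq.2 hcc
  have hUdisj : ∀ b : ℕ, (↑(Finset.range (N + 1)) : Set ℕ).PairwiseDisjoint (fun N'' => ⋃ w ∈ W b N'', T b N'' w) := by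
    intro b N'' _ N₁'' _ hne
    refine Set.disjoint_left.2 fun Λ hΛ hΛ₁ => hne ?_
    simp only [Set.mem_iUnion, exists_prop] at hΛ hΛ₁
    obtain ⟨w, -, hΛ⟩ := hΛ; obtain ⟨w₁, -, hΛ₁⟩ := hΛ₁
    exact (hdisj hΛ hΛ₁).choose_spec.choose_spec.2.2.1
  have hdisj1 : (↑(Finset.range (n + 1)) : Set ℕ).PairwiseDisjoint
      (fun b => ⋃ N'' ∈ (↑(Finset.range (N + 1)) : Set ℕ), ⋃ w ∈ W b N'', T b N'' w) := by
    intro b _ b₁ _ hne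
    refine Set.disjoint_left.2 fun Λ hΛ hΛ₁ => hne ?_
    simp only [Set.mem_iUnion, exists_prop] at hΛ hΛ₁
    obtain ⟨N'', -, w, -, hΛ⟩ := hΛ; obtain ⟨N₁'', -, w₁, -, hΛ₁⟩ := hΛ₁
    exact (hdisj hΛ hΛ₁).choose_spec.choose_spec.2.2.2.1
  -- ### 6. (S7) THE COUNT
  rw [hA, (Finset.range (n + 1)).finite_toSet.ncard_biUnion
      (fun b hb => hUfin b (by have := Finset.mem_range.1 (Finset.mem_coe.1 hb); omega)) hdisj1,
    finsum_mem_coe_finset, Finset.sum_filter]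
  refine Finset.sum_congr rfl fun b hb => ?_
  have hb' : b ≤ n := by have := Finset.mem_range.1 hb; omega
  rw [(Finset.range (N + 1)).finite_toSet.ncard_biUnion
      (fun N'' hN'' => hVfin b hb' N'' (by have := Finset.mem_range.1 (Finset.mem_coe.1 hN''); omega)) (hUdisj b),
    finsum_mem_coe_finset]
  by_cases hcls : b % 2 = cls
  · rw [if_pos hcls]
    refine Finset.sum_congr rfl fun N'' hN'' => ?_
    have hN''le : N'' ≤ N := by have := Finset.mem_range.1 hN''; omega
    rw [(hWfin b N'').ncard_biUnion (fun w hw => hTfin b hb' N'' hN''le w hw) (hVdisj b N''),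
      finsum_mem_congr rfl (fun w hw => (hval b hb' N'' hN''le w hw).1 hcls),
      finsum_mem_eq_finite_toFinset_sum _ (hWfin b N''), Finset.sum_const, smul_eq_mul, ← Set.ncard_eq_toFinset_card _ (hWfin b N''),
      mul_comm, ← Nat.card_coe_set_eq, hW]
    simp only [hP]
    rfl
  · rw [if_neg hcls]
    refine Finset.sum_eq_zero fun N'' hN'' => ?_
    have hN''le : N'' ≤ N := by have := Finset.mem_range.1 hN''; omega
    have hempty : (⋃ w ∈ W b N'', T b N'' w) = ∅ := by
      refine Set.eq_empty_of_forall_notMem fun Λ hΛ => ?_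
      simp only [Set.mem_iUnion, exists_prop] at hΛ
      obtain ⟨w, hw, hΛ⟩ := hΛ
      rw [(hval b hb' N'' hN''le w hw).2 hcls] at hΛ; exact hΛ
    rw [hempty, Set.ncard_empty]

end Total

end Literature.NumberTheory.Automorphic

end
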